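import Summits.NavierStokesRegularity.FunctionalMining.VelocityL4NonlinearPoincare
import Literature.Analysis.FunctionSpaces.TorusDiffMonomialBounds
import HarnessLib

/-!
# FunctionalMining — `L⁶`/`L⁸`/`L¹²` interpolation of a zero-mean field by `U = ∫|u|⁴` and
# `I = ∫|u|²|∇u|²` on `T³` (static inputs of the `L⁴` velocity-moment law, K0 row `EV.s=4|T_LD|G1`)

search for candidate a priori estimates; no regularity claim. Cell `pub-nsfunc`, prove seat
(gen 8). Static functional inequalities for a smooth zero-mean vector field `u` on the flat
three-torus; nothing here concerns Navier–Stokes solutions. Notation: `U := ∫‖u‖⁴`,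
`I := ∫‖u‖² ∑ₖ‖∂ₖu‖²`, `Z := ‖∇u‖₂² = gradNormSq u`, `A₆ := ∫‖u‖⁶`, `A₈ := ∫‖u‖⁸`, `A₁₂ := ∫‖u‖¹²`.

* the two interpolation steps `A₆² ≤ U·A₈`, `A₈² ≤ U·A₁₂` (`integral_norm_pow_six_sq_le`,
  `integral_norm_pow_eight_sq_le`; Cauchy–Schwarz = tree `Torus.integral_mul_le_sqrt_mul_sqrt`).
* `integral_norm_pow_twelve_le` — on `T³`: `A₁₂ ≤ 32 (64 C₆ + C_NP³) I³`, where `C₆` is the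
  tree's mean-zero Sobolev constant (`Torus.exists_integral_norm_pow_six_le_gradNormSq_cube`) and
  `C_NP = 1968·27` the nonlinear Poincaré constant (`VelocityL4.integral_norm_pow_four_le`):
  the Sobolev embedding applied to the smooth regularisation `W_ε = √(‖u‖²+ε)u` of `‖u‖u`
  (`‖u‖¹² ≤ ‖W_ε‖⁶`, `∑ₖ‖∂ₖW_ε‖² ≤ 4(‖u‖²+ε)∑ₖ‖∂ₖu‖²`, mean of `W_ε` bounded by `√(U + ε∫‖u‖²)`),
  then `ε → 0`.
These are the no-go seat's SIEVELD §3.5 steps `‖u‖₁₂^{4/3} = ‖|u|²‖₆^{2/3} ≲ D₀^{1/3}` and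
`‖u‖₆ ≤ ‖u‖₄^{1/2}‖u‖₁₂^{1/2}` for the row `EV.s=4`, in squared (Cauchy–Schwarz) form.
[ours; elementary given the tree's Sobolev embedding]
-/

noncomputable section

open MeasureTheory Finset
open scoped InnerProductSpace RealInnerProductSpace ContDiff

namespace Summit.NavierStokesRegularity.FunctionalMining

open Literature.Analysis.FunctionSpaces Literature.Analysis.FunctionSpaces.Torus

namespace VelocityL4

variable {d : Type*} [Fintype d] [DecidableEq d]

/-! ## 1. The two interpolation steps (Cauchy–Schwarz) -/

omit [DecidableEq d] in
/-- `A₆² ≤ U · A₈`: `(∫‖u‖⁶)² ≤ (∫‖u‖⁴)(∫‖u‖⁸)` (Cauchy–Schwarz with `‖u‖² · ‖u‖⁴`). [folklore] -/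
theorem integral_norm_pow_six_sq_le {u : UnitAddTorus d → EuclideanSpace ℝ d} (hu : Continuous u) :
    (∫ x, ‖u x‖ ^ 6) ^ 2 ≤ (∫ x, ‖u x‖ ^ 4) * ∫ x, ‖u x‖ ^ 8 := by
  have hc2 : Continuous fun x => ‖u x‖ ^ 2 := hu.norm.pow 2
  have hc4 : Continuous fun x => ‖u x‖ ^ 4 := hu.norm.pow 4
  have h := integral_mul_le_sqrt_mul_sqrt hc2 hc4
  have e1 : ∫ x, ‖u x‖ ^ 2 * ‖u x‖ ^ 4 = ∫ x, ‖u x‖ ^ 6 :=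
    integral_congr_ae (ae_of_all _ fun x => by ring)
  have e2 : ∫ x, (‖u x‖ ^ 2) ^ 2 = ∫ x, ‖u x‖ ^ 4 :=
    integral_congr_ae (ae_of_all _ fun x => by ring)
  have e3 : ∫ x, (‖u x‖ ^ 4) ^ 2 = ∫ x, ‖u x‖ ^ 8 :=
    integral_congr_ae (ae_of_all _ fun x => by ring)
  rw [e1, e2, e3] at h
  have h4 : 0 ≤ ∫ x, ‖u x‖ ^ 4 := integral_nonneg fun x => by positivity
  have h8 : 0 ≤ ∫ x, ‖u x‖ ^ 8 := integral_nonneg fun x => by positivity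
  have h6 : 0 ≤ ∫ x, ‖u x‖ ^ 6 := integral_nonneg fun x => by positivity
  calc (∫ x, ‖u x‖ ^ 6) ^ 2 ≤ (Real.sqrt (∫ x, ‖u x‖ ^ 4) * Real.sqrt (∫ x, ‖u x‖ ^ 8)) ^ 2 :=
        pow_le_pow_left₀ h6 h 2
    _ = (∫ x, ‖u x‖ ^ 4) * ∫ x, ‖u x‖ ^ 8 := by
        rw [mul_pow, Real.sq_sqrt h4, Real.sq_sqrt h8]

omit [DecidableEq d] in
/-- `A₈² ≤ U · A₁₂`: `(∫‖u‖⁸)² ≤ (∫‖u‖⁴)(∫‖u‖¹²)` (Cauchy–Schwarz with `‖u‖² · ‖u‖⁶`). [folklore] -/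
theorem integral_norm_pow_eight_sq_le {u : UnitAddTorus d → EuclideanSpace ℝ d} (hu : Continuous u) :
    (∫ x, ‖u x‖ ^ 8) ^ 2 ≤ (∫ x, ‖u x‖ ^ 4) * ∫ x, ‖u x‖ ^ 12 := by
  have hc2 : Continuous fun x => ‖u x‖ ^ 2 := hu.norm.pow 2
  have hc6 : Continuous fun x => ‖u x‖ ^ 6 := hu.norm.pow 6
  have h := integral_mul_le_sqrt_mul_sqrt hc2 hc6
  have e1 : ∫ x, ‖u x‖ ^ 2 * ‖u x‖ ^ 6 = ∫ x, ‖u x‖ ^ 8 :=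
    integral_congr_ae (ae_of_all _ fun x => by ring)
  have e2 : ∫ x, (‖u x‖ ^ 2) ^ 2 = ∫ x, ‖u x‖ ^ 4 :=
    integral_congr_ae (ae_of_all _ fun x => by ring)
  have e3 : ∫ x, (‖u x‖ ^ 6) ^ 2 = ∫ x, ‖u x‖ ^ 12 :=
    integral_congr_ae (ae_of_all _ fun x => by ring)
  rw [e1, e2, e3] at h
  have h4 : 0 ≤ ∫ x, ‖u x‖ ^ 4 := integral_nonneg fun x => by positivity
  have h12 : 0 ≤ ∫ x, ‖u x‖ ^ 12 := integral_nonneg fun x => by positivity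
  have h8 : 0 ≤ ∫ x, ‖u x‖ ^ 8 := integral_nonneg fun x => by positivity
  calc (∫ x, ‖u x‖ ^ 8) ^ 2 ≤ (Real.sqrt (∫ x, ‖u x‖ ^ 4) * Real.sqrt (∫ x, ‖u x‖ ^ 12)) ^ 2 :=
        pow_le_pow_left₀ h8 h 2
    _ = (∫ x, ‖u x‖ ^ 4) * ∫ x, ‖u x‖ ^ 12 := by
        rw [mul_pow, Real.sq_sqrt h4, Real.sq_sqrt h12]

omit [DecidableEq d] in
/-- `A₆⁴ ≤ U³ · A₁₂` (the two Cauchy–Schwarz steps combined). [folklore] -/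
theorem integral_norm_pow_six_pow_four_le {u : UnitAddTorus d → EuclideanSpace ℝ d}
    (hu : Continuous u) :
    (∫ x, ‖u x‖ ^ 6) ^ 4 ≤ (∫ x, ‖u x‖ ^ 4) ^ 3 * ∫ x, ‖u x‖ ^ 12 := by
  have h1 := integral_norm_pow_six_sq_le hu
  have h2 := integral_norm_pow_eight_sq_le hu
  have h4 : 0 ≤ ∫ x, ‖u x‖ ^ 4 := integral_nonneg fun x => by positivity
  have h6 : 0 ≤ ∫ x, ‖u x‖ ^ 6 := integral_nonneg fun x => by positivity
  have h8 : 0 ≤ ∫ x, ‖u x‖ ^ 8 := integral_nonneg fun x => by positivity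
  calc (∫ x, ‖u x‖ ^ 6) ^ 4 = ((∫ x, ‖u x‖ ^ 6) ^ 2) ^ 2 := by ring
    _ ≤ ((∫ x, ‖u x‖ ^ 4) * ∫ x, ‖u x‖ ^ 8) ^ 2 := pow_le_pow_left₀ (by positivity) h1 2
    _ = (∫ x, ‖u x‖ ^ 4) ^ 2 * (∫ x, ‖u x‖ ^ 8) ^ 2 := by ring
    _ ≤ (∫ x, ‖u x‖ ^ 4) ^ 2 * ((∫ x, ‖u x‖ ^ 4) * ∫ x, ‖u x‖ ^ 12) :=
        mul_le_mul_of_nonneg_left h2 (by positivity)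
    _ = (∫ x, ‖u x‖ ^ 4) ^ 3 * ∫ x, ‖u x‖ ^ 12 := by ring

/-! ## 2. `A₁₂ ≤ C I³` on `T³` through the regularisation `W_ε` -/

/-- Elementary: `(a + b)⁶ ≤ 32 (a⁶ + b⁶)` (convexity of `x⁶`). [folklore] -/
private theorem add_pow_six_le (a b : ℝ) :
    (a + b) ^ 6 ≤ 32 * (a ^ 6 + b ^ 6) := by
  have h1 : (a + b) ^ 2 ≤ 2 * (a ^ 2 + b ^ 2) := by nlinarith [sq_nonneg (a - b)]
  have h2 : ∀ {p q : ℝ}, 0 ≤ p → 0 ≤ q → (p + q) ^ 3 ≤ 4 * (p ^ 3 + q ^ 3) := by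
    intro p q hp hq; nlinarith [sq_nonneg (p - q), mul_nonneg hp hq]
  calc (a + b) ^ 6 = ((a + b) ^ 2) ^ 3 := by ring
    _ ≤ (2 * (a ^ 2 + b ^ 2)) ^ 3 := pow_le_pow_left₀ (by positivity) h1 3
    _ = 8 * (a ^ 2 + b ^ 2) ^ 3 := by ring
    _ ≤ 8 * (4 * ((a ^ 2) ^ 3 + (b ^ 2) ^ 3)) :=
        mul_le_mul_of_nonneg_left (h2 (sq_nonneg a) (sq_nonneg b)) (by norm_num)
    _ = 32 * (a ^ 6 + b ^ 6) := by ring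

/-- Elementary: `(p + εq)³ ≤ p³ + ε (p + q)³` for `p, q ≥ 0`, `0 ≤ ε ≤ 1`. [folklore] -/
private theorem add_smul_pow_three_le {p q ε : ℝ} (hp : 0 ≤ p) (hq : 0 ≤ q) (hε : 0 ≤ ε) (hε1 : ε ≤ 1) :
    (p + ε * q) ^ 3 ≤ p ^ 3 + ε * (p + q) ^ 3 := by
  have h2 : ε ^ 2 ≤ ε := by nlinarith
  have h3 : ε ^ 3 ≤ ε := by nlinarith
  have hA : 0 ≤ 3 * p * q ^ 2 := by positivity
  have hB : 0 ≤ q ^ 3 := by positivity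
  calc (p + ε * q) ^ 3
      = p ^ 3 + ε * (3 * p ^ 2 * q) + ε ^ 2 * (3 * p * q ^ 2) + ε ^ 3 * q ^ 3 := by ring
    _ ≤ p ^ 3 + ε * (3 * p ^ 2 * q) + ε * (3 * p * q ^ 2) + ε * q ^ 3 := by
        have e2 := mul_le_mul_of_nonneg_right h2 hA
        have e3 := mul_le_mul_of_nonneg_right h3 hB
        linarith
    _ = p ^ 3 + ε * (3 * p ^ 2 * q + 3 * p * q ^ 2 + q ^ 3) := by ring
    _ ≤ p ^ 3 + ε * (p + q) ^ 3 := by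
        have e : (p + q) ^ 3 = p ^ 3 + (3 * p ^ 2 * q + 3 * p * q ^ 2 + q ^ 3) := by ring
        have hle : 3 * p ^ 2 * q + 3 * p * q ^ 2 + q ^ 3 ≤ (p + q) ^ 3 := by
          rw [e]; linarith [pow_nonneg hp 3]
        have := mul_le_mul_of_nonneg_left hle hε
        linarith

/-- **`L¹²` by `I`.** Given a mean-zero Sobolev constant `C₆` (`∫‖v‖⁶ ≤ C₆ ‖∇v‖₂⁶`; on `T³`
the tree's `Torus.exists_integral_norm_pow_six_le_gradNormSq_cube`), for every smooth zero-mean `u`,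
`∫‖u‖¹² ≤ 32 (64 C₆ + (1968·d³)³) (∫‖u‖²∑ₖ‖∂ₖu‖²)³`.
Proof: Sobolev for the smooth zero-mean field `W_ε − ∫W_ε`, `W_ε = √(‖u‖²+ε)u`, the derivative
bound `gradNormSq W_ε ≤ 4(I + εZ)`, the mean bound `‖∫W_ε‖² ≤ U + ε∫‖u‖²`, `‖u‖¹² ≤ ‖W_ε‖⁶`,
`ε → 0`, and the nonlinear Poincaré inequality `U ≤ 1968 d³ I`. [ours] -/
theorem integral_norm_pow_twelve_le {C₆ : ℝ} (hC₆0 : 0 ≤ C₆)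
    (hC₆ : ∀ v : UnitAddTorus d → EuclideanSpace ℝ d, IsSmooth v → HasZeroMean v →
      ∫ x, ‖v x‖ ^ 6 ≤ C₆ * gradNormSq v ^ 3)
    {u : UnitAddTorus d → EuclideanSpace ℝ d} (hu : IsSmooth u) (h0 : HasZeroMean u) :
    ∫ x, ‖u x‖ ^ 12 ≤
      32 * (64 * C₆ + (1968 * (Fintype.card d : ℝ) ^ 3) ^ 3) *
        (∫ x, ‖u x‖ ^ 2 * ∑ k, ‖partialDeriv k u x‖ ^ 2) ^ 3 := by
  set I : ℝ := ∫ x, ‖u x‖ ^ 2 * ∑ k, ‖partialDeriv k u x‖ ^ 2 with hI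
  set U : ℝ := ∫ x, ‖u x‖ ^ 4 with hU
  set K : ℝ := ∫ x, ‖u x‖ ^ 2 with hK
  set Z : ℝ := gradNormSq u with hZ
  set CNP : ℝ := 1968 * (Fintype.card d : ℝ) ^ 3 with hCNP
  have huc : Continuous u := hu.continuous
  have hI0 : 0 ≤ I := integral_nonneg fun x => by positivity
  have hU0 : 0 ≤ U := integral_nonneg fun x => by positivity
  have hK0 : 0 ≤ K := integral_nonneg fun x => by positivity
  have hZ0 : 0 ≤ Z := gradNormSq_nonneg u
  have hNP : U ≤ CNP * I := integral_norm_pow_four_le hu h0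
  -- for every `0 < ε ≤ 1`: `A₁₂ ≤ 32 (64 C₆ (I+εZ)³ + (U+εK)³)`
  have hε : ∀ ε : ℝ, 0 < ε → ε ≤ 1 →
      ∫ x, ‖u x‖ ^ 12 ≤ 32 * (64 * C₆ * (I + ε * Z) ^ 3 + (U + ε * K) ^ 3) := by
    intro ε hε hε1
    set Wε : UnitAddTorus d → EuclideanSpace ℝ d := fun x => Real.sqrt (‖u x‖ ^ 2 + ε) • u x
      with hWε
    set cε : EuclideanSpace ℝ d := ∫ x, Wε x with hcε
    have hWεs : IsSmooth Wε := isSmooth_reg hu hε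
    have hWεc : Continuous Wε := hWεs.continuous
    -- Sobolev for `Wε − cε`
    have hsm : IsSmooth (fun x => Wε x - cε) := hWεs.sub (isSmooth_const cε)
    have hzm : HasZeroMean (fun x => Wε x - cε) := by
      show ∫ x, (Wε x - cε) = 0
      rw [integral_sub hWεc.integrable_unitAddTorus (integrable_const _), integral_const]
      simp [hcε]
    have hS := hC₆ _ hsm hzm
    have hg : gradNormSq (fun x => Wε x - cε) = gradNormSq Wε := by
      unfold gradNormSq
      refine integral_congr_ae (ae_of_all _ fun x => ?_)
      refine Finset.sum_congr rfl fun k _ => ?_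
      have e : (fun x => Wε x - cε) = Wε + fun _ => -cε := by
        funext y; simp [sub_eq_add_neg]
      have hcst : IsContDiff 1 (fun _ : UnitAddTorus d => -cε) := contDiff_const
      have hz : partialDeriv k (fun _ : UnitAddTorus d => -cε) x = 0 := by
        simp [Torus.partialDeriv, Torus.lineDeriv]
      rw [e, partialDeriv_add (hWεs.isContDiff (by simp)) hcst, Pi.add_apply, hz, add_zero]
    have hG : gradNormSq Wε ≤ 4 * (I + ε * Z) := by
      have h := gradNormSq_reg_le hu hε
      have hcs : Continuous fun x => ∑ k, ‖partialDeriv k u x‖ ^ 2 :=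
        continuous_finsetSum _ fun k _ => (hu.partialDeriv k).continuous.norm.pow 2
      have hi1 : Integrable (fun x => ‖u x‖ ^ 2 * ∑ k, ‖partialDeriv k u x‖ ^ 2) volume :=
        ((huc.norm.pow 2).mul hcs).integrable_unitAddTorus
      have hi2 : Integrable (fun x => ε * ∑ k, ‖partialDeriv k u x‖ ^ 2) volume :=
        hcs.integrable_unitAddTorus.const_mul ε
      have e : ∫ x, (‖u x‖ ^ 2 + ε) * ∑ k, ‖partialDeriv k u x‖ ^ 2 = I + ε * Z := by
        have e1 : (fun x => (‖u x‖ ^ 2 + ε) * ∑ k, ‖partialDeriv k u x‖ ^ 2) =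
            fun x => ‖u x‖ ^ 2 * ∑ k, ‖partialDeriv k u x‖ ^ 2 +
              ε * ∑ k, ‖partialDeriv k u x‖ ^ 2 := by
          funext x; ring
        rw [e1, integral_add hi1 hi2, integral_const_mul]
        rfl
      rw [e] at h; exact h
    have hG0 : 0 ≤ gradNormSq Wε := gradNormSq_nonneg _
    have h6 : ∫ x, ‖Wε x - cε‖ ^ 6 ≤ C₆ * (4 * (I + ε * Z)) ^ 3 := by
      calc ∫ x, ‖Wε x - cε‖ ^ 6 ≤ C₆ * gradNormSq (fun x => Wε x - cε) ^ 3 := hS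
        _ = C₆ * gradNormSq Wε ^ 3 := by rw [hg]
        _ ≤ C₆ * (4 * (I + ε * Z)) ^ 3 := by gcongr
    -- the mean: `‖cε‖² ≤ ∫‖Wε‖² = U + εK`
    have hW2 : ∫ x, ‖Wε x‖ ^ 2 = U + ε * K := by
      have e1 : (fun x => ‖Wε x‖ ^ 2) = fun x => ‖u x‖ ^ 4 + ε * ‖u x‖ ^ 2 := by
        funext x
        simp only [hWε, norm_smul, Real.norm_of_nonneg (Real.sqrt_nonneg _)]
        rw [mul_pow, Real.sq_sqrt (by positivity)]
        ring
      have hi4 : Integrable (fun x => ‖u x‖ ^ 4) volume := (huc.norm.pow 4).integrable_unitAddTorus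
      have hi2 : Integrable (fun x => ε * ‖u x‖ ^ 2) volume :=
        (huc.norm.pow 2).integrable_unitAddTorus.const_mul ε
      rw [e1, integral_add hi4 hi2, integral_const_mul]
    have hc : ‖cε‖ ^ 2 ≤ U + ε * K := by
      have h1 : ‖cε‖ ≤ ∫ x, ‖Wε x‖ := norm_integral_le_integral_norm _
      have h2 : ∫ x, ‖Wε x‖ ≤ Real.sqrt (∫ x, ‖Wε x‖ ^ 2) := integral_le_sqrt_integral_sq hWεc.norm
      have h3 : 0 ≤ ∫ x, ‖Wε x‖ ^ 2 := integral_nonneg fun x => sq_nonneg _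
      calc ‖cε‖ ^ 2 ≤ (Real.sqrt (∫ x, ‖Wε x‖ ^ 2)) ^ 2 := pow_le_pow_left₀ (norm_nonneg _) (h1.trans h2) 2
        _ = U + ε * K := by rw [Real.sq_sqrt h3, hW2]
    have hcK0 : 0 ≤ U + ε * K := by positivity
    have hc6 : ‖cε‖ ^ 6 ≤ (U + ε * K) ^ 3 := by
      calc ‖cε‖ ^ 6 = (‖cε‖ ^ 2) ^ 3 := by ring
        _ ≤ (U + ε * K) ^ 3 := pow_le_pow_left₀ (sq_nonneg _) hc 3
    -- pointwise: `‖u‖¹² ≤ ‖Wε‖⁶ ≤ 32 (‖Wε − cε‖⁶ + ‖cε‖⁶)`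
    have hpt : ∀ x, ‖u x‖ ^ 12 ≤ 32 * ‖Wε x - cε‖ ^ 6 + 32 * ‖cε‖ ^ 6 := by
      intro x
      have hs : ‖u x‖ ≤ Real.sqrt (‖u x‖ ^ 2 + ε) :=
        calc ‖u x‖ = Real.sqrt (‖u x‖ ^ 2) := (Real.sqrt_sq (norm_nonneg _)).symm
          _ ≤ Real.sqrt (‖u x‖ ^ 2 + ε) := Real.sqrt_le_sqrt (by linarith)
      have hnW : ‖Wε x‖ = Real.sqrt (‖u x‖ ^ 2 + ε) * ‖u x‖ := by
        simp only [hWε, norm_smul, Real.norm_of_nonneg (Real.sqrt_nonneg _)]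
      have h12 : ‖u x‖ ^ 12 ≤ ‖Wε x‖ ^ 6 := by
        rw [hnW, mul_pow]
        calc ‖u x‖ ^ 12 = ‖u x‖ ^ 6 * ‖u x‖ ^ 6 := by ring
          _ ≤ Real.sqrt (‖u x‖ ^ 2 + ε) ^ 6 * ‖u x‖ ^ 6 :=
              mul_le_mul_of_nonneg_right (pow_le_pow_left₀ (norm_nonneg _) hs 6) (by positivity)
      have htri : ‖Wε x‖ ≤ ‖Wε x - cε‖ + ‖cε‖ := by
        have := norm_add_le (Wε x - cε) cε; rwa [sub_add_cancel] at this
      have h6' : ‖Wε x‖ ^ 6 ≤ (‖Wε x - cε‖ + ‖cε‖) ^ 6 := pow_le_pow_left₀ (norm_nonneg _) htri 6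
      have h32 := add_pow_six_le ‖Wε x - cε‖ ‖cε‖
      linarith
    have hi : Integrable (fun x => 32 * ‖Wε x - cε‖ ^ 6 + 32 * ‖cε‖ ^ 6) volume :=
      ((((hWεc.sub continuous_const).norm.pow 6).const_mul 32).integrable_unitAddTorus).add
        (integrable_const _)
    have hia : Integrable (fun x => 32 * ‖Wε x - cε‖ ^ 6) volume :=
      (((hWεc.sub continuous_const).norm.pow 6).const_mul 32).integrable_unitAddTorus
    calc ∫ x, ‖u x‖ ^ 12 ≤ ∫ x, (32 * ‖Wε x - cε‖ ^ 6 + 32 * ‖cε‖ ^ 6) :=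
          integral_mono ((huc.norm.pow 12).integrable_unitAddTorus) hi hpt
      _ = 32 * (∫ x, ‖Wε x - cε‖ ^ 6) + 32 * ‖cε‖ ^ 6 := by
          rw [integral_add hia (integrable_const _), integral_const_mul, integral_const]
          simp
      _ ≤ 32 * (C₆ * (4 * (I + ε * Z)) ^ 3) + 32 * (U + ε * K) ^ 3 := by gcongr
      _ = 32 * (64 * C₆ * (I + ε * Z) ^ 3 + (U + ε * K) ^ 3) := by ring
  -- `ε → 0` (the bound is at most affine in `ε ∈ (0,1]`)
  have hmain : ∫ x, ‖u x‖ ^ 12 ≤ 32 * (64 * C₆ * I ^ 3 + U ^ 3) := by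
    refine le_of_forall_pos_lt_add fun η hη => ?_
    set B : ℝ := 32 * (64 * C₆ * (I + Z) ^ 3 + (U + K) ^ 3) with hB
    have hB0 : 0 ≤ B := by positivity
    set ε : ℝ := min 1 (η / (B + 1)) with hεdef
    have hε0 : 0 < ε := lt_min one_pos (by positivity)
    have hε1 : ε ≤ 1 := min_le_left _ _
    have hεη : ε * B < η := by
      have h1 : ε ≤ η / (B + 1) := min_le_right _ _
      calc ε * B ≤ η / (B + 1) * B := mul_le_mul_of_nonneg_right h1 hB0
        _ < η := by rw [div_mul_eq_mul_div, div_lt_iff₀ (by positivity)]; nlinarith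
    have h := hε ε hε0 hε1
    have c1 := add_smul_pow_three_le hI0 hZ0 hε0.le hε1
    have c2 := add_smul_pow_three_le hU0 hK0 hε0.le hε1
    have : 32 * (64 * C₆ * (I + ε * Z) ^ 3 + (U + ε * K) ^ 3) ≤
        32 * (64 * C₆ * I ^ 3 + U ^ 3) + ε * B := by
      rw [hB]; nlinarith [mul_nonneg hC₆0 (sub_nonneg.2 c1), sub_nonneg.2 c2]
    linarith
  -- insert the nonlinear Poincaré bound `U ≤ CNP · I`
  have hU3 : U ^ 3 ≤ CNP ^ 3 * I ^ 3 := by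
    rw [← mul_pow]; exact pow_le_pow_left₀ hU0 hNP 3
  calc ∫ x, ‖u x‖ ^ 12 ≤ 32 * (64 * C₆ * I ^ 3 + U ^ 3) := hmain
    _ ≤ 32 * (64 * C₆ * I ^ 3 + CNP ^ 3 * I ^ 3) := by gcongr
    _ = 32 * (64 * C₆ + CNP ^ 3) * I ^ 3 := by ring

end VelocityL4

end Summit.NavierStokesRegularity.FunctionalMining
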